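import Literature.CategoryTheory.Preadditive.Radical
import HarnessLib

/-!
# The radical of a Krull–Schmidt category along biproduct decompositions: `Rad(⊕ Xᵢ, ⊕ Yⱼ) = ⊕ Rad(Xᵢ, Yⱼ)` with
# `Rad(Xᵢ, Yⱼ)` = the non-invertible morphisms (Krause §4)

Topic `Literature/CategoryTheory/Preadditive`, namespace `Literature.CategoryTheory.KrullSchmidt`; sequel of `Radical` (g40-#1: `rad X Y`,
two-sided ideal, `mem_rad_iff_biproduct`, `mem_rad_iff_not_isIso` for local endomorphism rings).  Here the two are combined into Krause's
description of the radical of a Krull–Schmidt category along decompositions into objects with LOCAL endomorphism rings, for Mathlib's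
binary and finite biproducts, together with the transport of the radical along isomorphisms and the resulting description of the
Jacobson radical of `End(⊕ Xᵢ)`.  Everything proved; no definition, no named fact, no instance, no notation (net debt 0).

## The source, verbatim

H. Krause, *Krull–Schmidt categories and projective covers* [Krause2015KS], §4 (p. 545): «An additive category is called Krull–Schmidt
category if every object decomposes into a finite direct sum of objects having local endomorphism rings»; after Cor. 4.4 (p. 546): «Let `𝒜`
be a Krull–Schmidt category and let `X = X₁ ⊕ … ⊕ X_r` and `Y = Y₁ ⊕ … ⊕ Y_s` be decompositions of two objects `X, Y` into indecomposable
objects. Then we have `Rad_𝒜(X,Y) = ⊕ᵢ,ⱼ Rad_𝒜(Xᵢ,Yⱼ)` and `Rad_𝒜(Xᵢ,Yⱼ)` equals the set of non-invertible morphisms `Xᵢ → Yⱼ` for each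
pair `i, j`.»; §2 (p. 539): «Note that a morphism `(φᵢⱼ) : ⊕ᵢ Xᵢ → ⊕ⱼ Yⱼ` belongs to an ideal `𝔍` if and only if `φᵢⱼ ∈ 𝔍` for all `i, j`»;
Prop. 2.9: «`Rad_𝒜(X,X) = J(End_𝒜(X))`».  I. Assem, D. Simson, A. Skowroński [AssemSkowronskiSimson2006], A.3 Prop. 3.5 (b): «if `X ≇ Y` then
`rad_𝒞(X,Y) = Hom_𝒞(X,Y)`».

## What is formalised (preadditive `C`; «indecomposable» = local endomorphism ring, as in Krause's definition of a Krull–Schmidt category)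

* §1 transport: `comp_iso_mem_rad_iff`, `iso_comp_mem_rad_iff`, **`mem_rad_iff_of_iso`** (`φ ∈ Rad(X,Y) ⟺ i⁻¹ φ j ∈ Rad(X',Y')`).
* §2 binary sums `X₁ ⊞ X₂ ⟶ Y₁ ⊞ Y₂` of local-`End` objects: **`mem_rad_biprod_iff_not_isIso`** (radical ⟺ the four blocks are
  non-isomorphisms).
* §3 finite biproducts `⨁ f ⟶ ⨁ g` of local-`End` objects: **`mem_rad_biproduct_iff_forall_not_isIso`** (Krause §4 verbatim),
  `rad_biproduct_eq_top_iff_forall_isEmpty_iso` (`Rad(X,Y) = Hom(X,Y)` ⟺ no `Xᵢ ≅ Yⱼ`), **`end_biproduct_mem_jacobson_iff`**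
  (`φ ∈ J(End(⊕ Xᵢ)) ⟺` no block `ιᵢ φ πⱼ` is an isomorphism) and, for pairwise non-isomorphic summands,
  `end_biproduct_mem_jacobson_iff_forall_diag` (only the diagonal blocks matter).
* §4 objects GIVEN with a decomposition `X ≅ ⨁ f`, `Y ≅ ⨁ g`: `mem_rad_iff_forall_not_isIso_of_iso` (§1 + §3).

## Mathlib ∕ Literature search

Mathlib: `biproduct.ι_π_self`, `biproduct.ι_π_ne`, `biprod.inl_fst` &c., `Iso`; no radical of a category in Mathlib (see g40-#1).  Tree REUSED:
g40-#1 (`rad`, `comp_mem_rad`, `mem_rad_comp`, `mem_rad_iff_biprod`, `mem_rad_iff_biproduct`, `mem_rad_iff_not_isIso`, `not_isIso_of_mem_rad`,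
`mem_rad_self_iff`); the sibling Krull–Schmidt files (`KrullSchmidtObjects`, `KrullSchmidtUniqueness`) supply decompositions `X ≅ ⨁ f` with
local `End (f j)` but do not mention the radical (`rg "rad " Literature/CategoryTheory/Preadditive/KrullSchmidt*` → nothing).

## References

* H. Krause, *Krull–Schmidt categories and projective covers*, Expo. Math. 33 (2015) 535–549: §2 (before Prop. 2.9), Prop. 2.9, §4
  (definition of Krull–Schmidt category; remark after Cor. 4.4). [Krause2015KS]
* I. Assem, D. Simson, A. Skowroński, *Elements of the Representation Theory of Associative Algebras 1* (2006): A.3 Lemma 3.4 (b),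
  Prop. 3.5 (b). [AssemSkowronskiSimson2006]

## Provenance

Lane `lit-hodgefound` (summit `HodgeConjecture`, Track 2 foundations library), seat `lit-hodgefound-p36` (literature-prover, generation 40,
row g40-#5); Krause materialised as `paper-arxiv-1410.2822` (p0008–p0009).
-/

open CategoryTheory CategoryTheory.Limits

namespace Literature.CategoryTheory.KrullSchmidt

universe v u

variable {C : Type u} [Category.{v} C] [Preadditive C]

/-! ## §1 Transport of the radical along isomorphisms -/

section Transport

variable {X X' Y Y' : C}

/-- `φ ≫ j ∈ Rad(X,Y')` iff `φ ∈ Rad(X,Y)` for an isomorphism `j : Y ≅ Y'` (two-sided ideal). [cite: Krause2015KS, §2 Prop. 2.9] -/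
theorem comp_iso_mem_rad_iff (φ : X ⟶ Y) (j : Y ≅ Y') : φ ≫ j.hom ∈ rad X Y' ↔ φ ∈ rad X Y := by
  refine ⟨fun h => ?_, fun h => mem_rad_comp j.hom h⟩
  simpa only [Category.assoc, Iso.hom_inv_id, Category.comp_id] using mem_rad_comp j.inv h

/-- `i ≫ φ ∈ Rad(X',Y)` iff `φ ∈ Rad(X,Y)` for an isomorphism `i : X' ≅ X`. [cite: Krause2015KS, §2 Prop. 2.9] -/
theorem iso_comp_mem_rad_iff (i : X' ≅ X) (φ : X ⟶ Y) : i.hom ≫ φ ∈ rad X' Y ↔ φ ∈ rad X Y := by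
  refine ⟨fun h => ?_, fun h => comp_mem_rad i.hom h⟩
  simpa only [Iso.inv_hom_id_assoc] using comp_mem_rad i.inv h

/-- **The radical is invariant under isomorphisms of source and target**: `φ ∈ Rad(X,Y) ⟺ i⁻¹ ≫ φ ≫ j ∈ Rad(X',Y')` for `i : X ≅ X'`,
`j : Y ≅ Y'`. [cite: Krause2015KS, §2 Prop. 2.9] -/
theorem mem_rad_iff_of_iso (i : X ≅ X') (j : Y ≅ Y') (φ : X ⟶ Y) : φ ∈ rad X Y ↔ i.inv ≫ φ ≫ j.hom ∈ rad X' Y' := by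
  refine ⟨fun h => comp_mem_rad_comp i.inv j.hom h, fun h => ?_⟩
  simpa only [Category.assoc, Iso.hom_inv_id_assoc, Iso.hom_inv_id, Category.comp_id] using comp_mem_rad_comp i.hom j.inv h

end Transport

/-! ## §2 Binary sums of objects with local endomorphism rings -/

section Biprod

variable {X₁ X₂ Y₁ Y₂ : C} [HasBinaryBiproduct X₁ X₂] [HasBinaryBiproduct Y₁ Y₂]

/-- **`φ : X₁ ⊞ X₂ ⟶ Y₁ ⊞ Y₂` is radical iff none of its four blocks is an isomorphism**, for `Xᵢ`, `Yⱼ` with local endomorphism rings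
(Krause §4 with `r, s ≤ 2`). [cite: Krause2015KS, §4 (after Cor. 4.4)] [cite: AssemSkowronskiSimson2006, A.3 Lemma 3.4 (b), Prop. 3.5 (b)] -/
theorem mem_rad_biprod_iff_not_isIso [IsLocalRing (End X₁)] [IsLocalRing (End X₂)] [IsLocalRing (End Y₁)] [IsLocalRing (End Y₂)]
    (φ : X₁ ⊞ X₂ ⟶ Y₁ ⊞ Y₂) :
    φ ∈ rad (X₁ ⊞ X₂) (Y₁ ⊞ Y₂) ↔
      ¬IsIso (biprod.inl ≫ φ ≫ biprod.fst) ∧ ¬IsIso (biprod.inl ≫ φ ≫ biprod.snd) ∧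
        ¬IsIso (biprod.inr ≫ φ ≫ biprod.fst) ∧ ¬IsIso (biprod.inr ≫ φ ≫ biprod.snd) := by
  rw [mem_rad_iff_biprod, mem_rad_iff_not_isIso, mem_rad_iff_not_isIso, mem_rad_iff_not_isIso, mem_rad_iff_not_isIso]

end Biprod

/-! ## §3 Finite biproducts of objects with local endomorphism rings (Krause §4) -/

section Biproduct

variable {J K : Type} [Fintype J] [Fintype K] {f : J → C} {g : K → C} [HasBiproduct f] [HasBiproduct g]

/-- **Krause §4: for decompositions `X = ⊕ Xᵢ`, `Y = ⊕ Yⱼ` into objects with local endomorphism rings, a morphism `φ : X ⟶ Y` is radical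
iff no component `ιᵢ ≫ φ ≫ πⱼ : Xᵢ ⟶ Yⱼ` is an isomorphism** («`Rad_𝒜(X,Y) = ⊕ Rad_𝒜(Xᵢ,Yⱼ)` and `Rad_𝒜(Xᵢ,Yⱼ)` equals the set of
non-invertible morphisms»). [cite: Krause2015KS, §4 (after Cor. 4.4)] [cite: AssemSkowronskiSimson2006, A.3 Lemma 3.4 (b), Prop. 3.5 (b)] -/
theorem mem_rad_biproduct_iff_forall_not_isIso [∀ j, IsLocalRing (End (f j))] [∀ k, IsLocalRing (End (g k))] (φ : ⨁ f ⟶ ⨁ g) :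
    φ ∈ rad (⨁ f) (⨁ g) ↔ ∀ j k, ¬IsIso (biproduct.ι f j ≫ φ ≫ biproduct.π g k) := by
  rw [mem_rad_iff_biproduct]
  exact forall_congr' fun j => forall_congr' fun k => mem_rad_iff_not_isIso _

omit [Fintype J] [Fintype K] in
/-- The `(j, k)` component of `πⱼ ≫ e ≫ ιₖ : ⨁ f ⟶ ⨁ g` is `e`. [cite: Krause2015KS, §4] -/
theorem ι_comp_π_comp_comp_ι_comp_π (j : J) (k : K) (e : f j ⟶ g k) :
    biproduct.ι f j ≫ (biproduct.π f j ≫ e ≫ biproduct.ι g k) ≫ biproduct.π g k = e := by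
  simp only [Category.assoc, biproduct.ι_π_self_assoc, biproduct.ι_π_self, Category.comp_id]

/-- **`Rad(⊕ Xᵢ, ⊕ Yⱼ) = Hom(⊕ Xᵢ, ⊕ Yⱼ)` iff no `Xᵢ` is isomorphic to a `Yⱼ`** (ASS: «if `X ≇ Y` then `rad_𝒞(X,Y) = Hom_𝒞(X,Y)`», summand by
summand). [cite: Krause2015KS, §4 (after Cor. 4.4)] [cite: AssemSkowronskiSimson2006, A.3 Prop. 3.5 (b)] -/
theorem rad_biproduct_eq_top_iff_forall_isEmpty_iso [∀ j, IsLocalRing (End (f j))] [∀ k, IsLocalRing (End (g k))] :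
    rad (⨁ f) (⨁ g) = ⊤ ↔ ∀ j k, IsEmpty (f j ≅ g k) := by
  classical
  constructor
  · intro h j k
    refine ⟨fun e => ?_⟩
    have hφ : biproduct.π f j ≫ e.hom ≫ biproduct.ι g k ∈ rad (⨁ f) (⨁ g) := h ▸ AddSubgroup.mem_top _
    have h1 := (mem_rad_biproduct_iff_forall_not_isIso _).1 hφ j k
    rw [ι_comp_π_comp_comp_ι_comp_π] at h1
    exact h1 inferInstance
  · intro h
    refine eq_top_iff.2 fun φ _ => (mem_rad_biproduct_iff_forall_not_isIso φ).2 fun j k hiso => ?_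
    exact (h j k).false (asIso (biproduct.ι f j ≫ φ ≫ biproduct.π g k))

/-- **The Jacobson radical of `End(⊕ Xᵢ)`**: `φ ∈ J(End(⊕ Xᵢ))` iff no block `ιᵢ ≫ φ ≫ πⱼ : Xᵢ ⟶ Xⱼ` is an isomorphism
(`Rad(X,X) = J(End X)` and Krause §4). [cite: Krause2015KS, §2 Prop. 2.9, §4 (after Cor. 4.4)] -/
theorem end_biproduct_mem_jacobson_iff [∀ j, IsLocalRing (End (f j))] (φ : End (⨁ f)) :
    φ ∈ Ring.jacobson (End (⨁ f)) ↔ ∀ j j', ¬IsIso (biproduct.ι f j ≫ End.asHom φ ≫ biproduct.π f j') := by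
  rw [← mem_rad_self_iff]
  exact mem_rad_biproduct_iff_forall_not_isIso _

/-- For PAIRWISE NON-ISOMORPHIC summands with local endomorphism rings only the diagonal blocks matter:
`φ ∈ J(End(⊕ Xᵢ))` iff no `ιᵢ ≫ φ ≫ πᵢ` is an automorphism of `Xᵢ` (off-diagonal blocks are never isomorphisms).
[cite: Krause2015KS, §4 (after Cor. 4.4)] [cite: AssemSkowronskiSimson2006, A.3 Prop. 3.5 (b)] -/
theorem end_biproduct_mem_jacobson_iff_forall_diag [∀ j, IsLocalRing (End (f j))] (hne : ∀ j j', j ≠ j' → IsEmpty (f j ≅ f j'))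
    (φ : End (⨁ f)) :
    φ ∈ Ring.jacobson (End (⨁ f)) ↔ ∀ j, ¬IsIso (biproduct.ι f j ≫ End.asHom φ ≫ biproduct.π f j) := by
  rw [end_biproduct_mem_jacobson_iff]
  refine ⟨fun h j => h j j, fun h j j' hiso => ?_⟩
  by_cases hjj' : j = j'
  · subst hjj'
    exact h j hiso
  · exact (hne j j' hjj').false (asIso (biproduct.ι f j ≫ End.asHom φ ≫ biproduct.π f j'))

/-- Into a single local-`End` object: `φ : ⨁ f ⟶ Y` is radical iff no `ιⱼ ≫ φ` is an isomorphism. [cite: Krause2015KS, §4 (after Cor. 4.4)] -/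
theorem mem_rad_biproduct_left_iff [∀ j, IsLocalRing (End (f j))] {Y : C} [IsLocalRing (End Y)] (φ : ⨁ f ⟶ Y) :
    φ ∈ rad (⨁ f) Y ↔ ∀ j, ¬IsIso (biproduct.ι f j ≫ φ) := by
  classical
  constructor
  · intro h j hiso
    exact not_isIso_of_mem_rad (comp_mem_rad (biproduct.ι f j) h) hiso
  · intro h
    have hφ : φ = ∑ j, biproduct.π f j ≫ (biproduct.ι f j ≫ φ) := by
      conv_lhs => rw [← Category.id_comp φ, ← biproduct.total, Preadditive.sum_comp]
      simp only [Category.assoc]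
    rw [hφ]
    exact sum_mem fun j _ => comp_mem_rad _ ((mem_rad_iff_not_isIso _).2 (h j))

/-- Out of a single local-`End` object: `φ : X ⟶ ⨁ g` is radical iff no `φ ≫ πₖ` is an isomorphism. [cite: Krause2015KS, §4 (after Cor. 4.4)] -/
theorem mem_rad_biproduct_right_iff [∀ k, IsLocalRing (End (g k))] {X : C} [IsLocalRing (End X)] (φ : X ⟶ ⨁ g) :
    φ ∈ rad X (⨁ g) ↔ ∀ k, ¬IsIso (φ ≫ biproduct.π g k) := by
  classical
  constructor
  · intro h k hiso
    exact not_isIso_of_mem_rad (mem_rad_comp (biproduct.π g k) h) hiso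
  · intro h
    have hφ : φ = ∑ k, (φ ≫ biproduct.π g k) ≫ biproduct.ι g k := by
      conv_lhs => rw [← Category.comp_id φ, ← biproduct.total, Preadditive.comp_sum]
      simp only [Category.assoc]
    rw [hφ]
    exact sum_mem fun k _ => mem_rad_comp _ ((mem_rad_iff_not_isIso _).2 (h k))

end Biproduct

/-! ## §4 Objects given with a decomposition -/

section Decomposed

variable {J K : Type} [Fintype J] [Fintype K] {f : J → C} {g : K → C} [HasBiproduct f] [HasBiproduct g]
variable {X Y : C}

/-- **Krause §4 for objects `X ≅ ⊕ Xᵢ`, `Y ≅ ⊕ Yⱼ` of a Krull–Schmidt category**: `φ : X ⟶ Y` is radical iff no component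
`ιᵢ ≫ i⁻¹ ≫ φ ≫ i' ≫ πⱼ : Xᵢ ⟶ Yⱼ` is an isomorphism. [cite: Krause2015KS, §4 (definition and remark after Cor. 4.4)] -/
theorem mem_rad_iff_forall_not_isIso_of_iso [∀ j, IsLocalRing (End (f j))] [∀ k, IsLocalRing (End (g k))] (i : X ≅ ⨁ f) (i' : Y ≅ ⨁ g)
    (φ : X ⟶ Y) : φ ∈ rad X Y ↔ ∀ j k, ¬IsIso (biproduct.ι f j ≫ (i.inv ≫ φ ≫ i'.hom) ≫ biproduct.π g k) := by
  rw [mem_rad_iff_of_iso i i' φ]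
  exact mem_rad_biproduct_iff_forall_not_isIso _

/-- For such objects, every morphism `X ⟶ Y` is radical iff no summand of `X` is isomorphic to a summand of `Y`.
[cite: Krause2015KS, §4 (after Cor. 4.4)] [cite: AssemSkowronskiSimson2006, A.3 Prop. 3.5 (b)] -/
theorem rad_eq_top_iff_forall_isEmpty_iso_of_iso [∀ j, IsLocalRing (End (f j))] [∀ k, IsLocalRing (End (g k))] (i : X ≅ ⨁ f)
    (i' : Y ≅ ⨁ g) : rad X Y = ⊤ ↔ ∀ j k, IsEmpty (f j ≅ g k) := by
  rw [← rad_biproduct_eq_top_iff_forall_isEmpty_iso (f := f) (g := g)]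
  constructor
  · intro h
    refine eq_top_iff.2 fun ψ _ => ?_
    have h1 : i.hom ≫ ψ ≫ i'.inv ∈ rad X Y := h ▸ AddSubgroup.mem_top _
    have h2 := (mem_rad_iff_of_iso i i' _).1 h1
    simpa only [Category.assoc, Iso.inv_hom_id_assoc, Iso.inv_hom_id, Category.comp_id] using h2
  · intro h
    refine eq_top_iff.2 fun φ _ => ?_
    rw [mem_rad_iff_of_iso i i' φ, h]
    exact AddSubgroup.mem_top _

/-- The Jacobson radical of `End X` for `X ≅ ⊕ Xᵢ` with local `End Xᵢ`: `φ ∈ J(End X)` iff no block of `i⁻¹ φ i` is an isomorphism.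
[cite: Krause2015KS, §2 Prop. 2.9, §4 (after Cor. 4.4)] -/
theorem end_mem_jacobson_iff_of_iso [∀ j, IsLocalRing (End (f j))] (i : X ≅ ⨁ f) (φ : End X) :
    φ ∈ Ring.jacobson (End X) ↔ ∀ j j', ¬IsIso (biproduct.ι f j ≫ (i.inv ≫ End.asHom φ ≫ i.hom) ≫ biproduct.π f j') := by
  rw [← mem_rad_self_iff]
  exact mem_rad_iff_forall_not_isIso_of_iso i i _

end Decomposed

end Literature.CategoryTheory.KrullSchmidt
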